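import Summits.BirchSwinnertonDyer.BirchSwinnertonDyer.Theses.QuadraticBranchSignedControl
import Summits.BirchSwinnertonDyer.Rank1Residual.Additive.QuadraticBranchKatoBridge
import Summits.BirchSwinnertonDyer.Rank1Residual.Additive.LocIrrOddPrimes
import Literature.NumberTheory.EllipticCurves.BSDSelmerPConverseSerreProofs
import HarnessLib

/-!
# Route `QuadraticBranchSignedControl` (rung K8, cell `bsd-potss`), crux `PlusLowerInclusionSurjBranch`
# (item stmt-BirchSwinnertonDyer-19242): the REGISTERED child stubs BY SIGNATURE, their conditional
# closers over the two Fouquet–Wan shapes, and the locus composition in the tree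

WHAT. The planner's BC3 child skeleton of crux 19242 (`Cruxes/PlusLowerInclusionSurjBranch`,
`plan/percrux4/K8_PlusLowerInclusionSurjBranch_birth.lean`, registered 2026-08-26T03:48Z, namespace
`…Cruxes.PlusLowerInclusionSurjBranch.Birth`) cuts the Eisenstein inclusion (E⁺)
`QuadraticBranchPlusLowerInclusionAt V p` on the `p`-adic-tower-onto Gss2 twists `V` by LOCUS:
* `stub_plusLower_fwLocus` — (E⁺) on the twists INSIDE the Fouquet–Wan sub-locus `FWLocus V p` (`V`
  has a Gss2 partner `W`, `C • W^{(p*)} = V`, `Addv W p ∧ SubGss W p`, with a non-split multiplicative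
  prime at which `W[p]` is ramified and `SL₂(ℤ_p) ⊆ im ρ_{W,p^∞}`: `FWNonsplitRam W p ∧
  Kato2004.ImageContainsSL2 W p`);
* `stub_plusLower_offLocus` — (E⁺) on the tower-onto twists OUTSIDE it (nothing in print: THE open
  residue of the crux);
* plan-only BC5 rung `stub_plusLower_five_rung` — the `p = 5` rows of the sub-locus;
with the composition `PlusLowerInclusionSurjBranch_of hfw hoff`. The `Sig.*` abbreviations live only
in the planner's local skeleton, so this file states each of them VERBATIM (binder for binder, the
abbreviation `FWLocus V p` unfolded to its `∃`-datum) and proves, as tool theorems: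
* `stub_plusLower_fwLocus_of_shapes` — **`Sig.stub_plusLower_fwLocus` from the two HYPOTHESIS SHAPES**
  `FouquetWanClaimShape KMC` (Fouquet–Wan arXiv:2107.13726 Thm. 5.1 / 1.7, an UNREFEREED CLAIM,
  hypothesis only) and `QuadraticBranchKatoBridge KMC` (Kobayashi Thm. 7.4 at `η` + the zeta-element
  twist comparison, hypothesis only) — a repackaging of g0's
  `plusLowerInclusion_on_fouquetWanLocus_of_shapes` (p419739); the tower-surjectivity binder of the
  stub is not even used;
* `stub_plusLower_five_rung_of_fwLocus` / `…_of_shapes` — the BC5 rung is the `p = 5` instance of the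
  sub-locus stub (so it inherits the same conditional closer);
* `plusLowerInclusionSurjBranch_of_fwLocus_of_offLocus` — the skeleton's composition `_of` in the
  tree (crux BY NAME from the two stubs, `by_cases` on the locus);
* `plusLowerInclusionSurjBranch_of_shapes_of_offLocus` — **the crux BY NAME from the two shapes + the
  off-locus stub ALONE**: modulo the Fouquet–Wan claim and the bridge, item 19242 IS
  `Sig.stub_plusLower_offLocus` (the K8 analogue of the K8-t′ / K9 reductions
  `tameLowerHalfRankZero_of_offLocus_of_fouquetWanClaim`, `wildLowerHalfRankZero_of_fwClaim_of_residualRows`);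
* `plusLowerInclusionSurjBranch_iff_modP` — at `p ≥ 5` the crux's tower hypothesis
  `∀ m, ρ_{V,p^m} onto` is equivalent to `ρ̄_{V,p}` onto (Serre, IV-23 Lemma 3; tree theorem
  `serre_hasSurjectiveModNGaloisRep_pow_holds`), so the crux may be read with the mod-`p` condition —
  the form in which the census decides the locus per pair.

HONEST FRAMING (cell `bsd-potss`, run/shared/lean/pub/bsd-potss/; FULL-BSD rank ≤ 1 programme, HUMAN
RULING D-0036/D-0074): TOOL THEOREMS ONLY — no definition, no named fact minted, no `sorry`, axioms
standard. Everything here is CONDITIONAL on displayed hypotheses (two SHAPES, one transcribing an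
unrefereed preprint, and/or the open off-locus stub); nothing is asserted about any curve; the crux
19242, its parent 19114 and the route are NOT closed; the Eisenstein inclusion for the additive twist
stays OPEN off the sub-locus (and merely CLAIMED on it); nothing is booked; `BSD(W, p)` is claimed for
no pair; this is not "finishing BSD". Seat `bsd-potss-k8q-c2` (prover), g2;
`--supports stmt-BirchSwinnertonDyer-19242 --as helper`.

References: [FouquetWan2021] Thm. 5.1 / Thm. 1.7 (claim; hypothesis only); [Kobayashi2003] §4 (p. 8),
Thm. 7.4 (p. 13); [Kato2004Asterisque] Conj. 12.10 (p. 224); [SerreAbelianLadic1968] Ch. IV §3.4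
Lemma 3 (IV-23) (mod `p` onto ⟹ `p`-adic onto, `p ≥ 5`).
-/

set_option autoImplicit false
set_option linter.dupNamespace false

noncomputable section

open scoped Classical

open WeierstrassCurve
open Literature.NumberTheory.EllipticCurves
open Literature.NumberTheory.EllipticCurves.Rank1Residual
open Summit.BirchSwinnertonDyer.Rank1Residual.Additive
open Summit.BirchSwinnertonDyer.BirchSwinnertonDyer.Theses.QuadraticBranchSignedControl

namespace Summit.BirchSwinnertonDyer.BirchSwinnertonDyer.Theorems

variable {KMC : ∀ (W : WeierstrassCurve ℚ) [W.IsElliptic] [W.IsGloballyMinimal] (p : ℕ), Prop}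

/-! ## §1 The sub-locus stub and the BC5 rung, from the two shapes -/

/-- **`Sig.stub_plusLower_fwLocus` (registered stub of crux 19242, VERBATIM) from the two shapes.**
Granted `FouquetWanClaimShape KMC` (Fouquet–Wan Thm. 5.1/1.7 — an unrefereed CLAIM, hypothesis only)
and the bridge `QuadraticBranchKatoBridge KMC` (hypothesis only): for every good `a_p = 0` twist `V`,
`p ≥ 5`, whose `p`-adic tower is onto and which lies in the Fouquet–Wan sub-locus (a Gss2 partner `W`
with `FWNonsplitRam W p ∧ Kato2004.ImageContainsSL2 W p`), the Eisenstein inclusion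
`QuadraticBranchPlusLowerInclusionAt V p` holds. Same composition as
`plusLowerInclusion_on_fouquetWanLocus_of_shapes` (p419739: `LocIrr W p` automatic on Gss2 by
`locIrr_of_subGss`, the claim-shape gives `KMC W p`, the bridge gives (C1_η)(V), whose lower half is
(E⁺)); the tower binder of the stub is unused. CONDITIONAL; closes nothing.
[cite: Serre1972, §1.11 Prop. 12 (LocIrr at a supersingular prime)]
[cite: FouquetWan2021, Thm. 5.1 and Thm. 1.7 (claim; hypothesis only)]
[cite: Kobayashi2003, §4 (p. 8) and Thm. 7.4 (p. 13)] -/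
theorem stub_plusLower_fwLocus_of_shapes
    (hFW : FouquetWanClaimShape KMC) (hB : QuadraticBranchKatoBridge KMC) :
    ∀ (V : WeierstrassCurve ℚ) [V.IsElliptic] [V.IsGloballyMinimal] (p : ℕ) [Fact p.Prime],
      5 ≤ p → V.HasGoodReductionAtPrime p → V.frobeniusTrace p = 0 →
      (∀ m : ℕ, V.HasSurjectiveModNGaloisRep (p ^ m : ℕ)) →
      (∃ (W : WeierstrassCurve ℚ) (_ : W.IsElliptic) (_ : W.IsGloballyMinimal) (C : VariableChange ℚ),
        C • W.quadraticTwist ((-1) ^ (p / 2) * p) = V ∧ Addv W p ∧ SubGss W p ∧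
          FWNonsplitRam W p ∧ Kato2004.ImageContainsSL2 W p) →
      QuadraticBranchPlusLowerInclusionAt V p := by
  intro V _ _ p _ hp5 hgood hap _ hW
  obtain ⟨W, _, _, C, hWV, hadd, hG, hR, hK⟩ := hW
  have hp2 : p ≠ 2 := by omega
  have hL : LocIrr W p := locIrr_of_subGss W p hp5 hadd hG
  -- (C1_η)(V) from the claim-shape (⟹ KMC W p on ClassX4 ∧ LocIrr ∧ FWNonsplitRam) and the bridge,
  -- then (E⁺) as its lower half (`quadraticBranchPlusLowerInclusionAt_of_plusMainConjectureAt`)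
  exact quadraticBranchPlusLowerInclusionAt_of_plusMainConjectureAt
    (plusMC_of_kmc_of_bridge hB W V C p hp2 hWV hgood hap hK
      (hFW W p (classX4_of_addv_of_locIrr W p hp2 hadd hL) hL hR))

/-- **The BC5 rung `Sig.stub_plusLower_five_rung` (VERBATIM) is the `p = 5` instance of the
sub-locus stub `Sig.stub_plusLower_fwLocus`** (displayed as the hypothesis `hfw`). Pure
specialisation; CONDITIONAL on `hfw`; closes nothing. [folklore] -/
theorem stub_plusLower_five_rung_of_fwLocus
    (hfw : ∀ (V : WeierstrassCurve ℚ) [V.IsElliptic] [V.IsGloballyMinimal] (p : ℕ) [Fact p.Prime],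
      5 ≤ p → V.HasGoodReductionAtPrime p → V.frobeniusTrace p = 0 →
      (∀ m : ℕ, V.HasSurjectiveModNGaloisRep (p ^ m : ℕ)) →
      (∃ (W : WeierstrassCurve ℚ) (_ : W.IsElliptic) (_ : W.IsGloballyMinimal) (C : VariableChange ℚ),
        C • W.quadraticTwist ((-1) ^ (p / 2) * p) = V ∧ Addv W p ∧ SubGss W p ∧
          FWNonsplitRam W p ∧ Kato2004.ImageContainsSL2 W p) →
      QuadraticBranchPlusLowerInclusionAt V p) :
    ∀ (V : WeierstrassCurve ℚ) [V.IsElliptic] [V.IsGloballyMinimal] [Fact (5 : ℕ).Prime],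
      V.HasGoodReductionAtPrime 5 → V.frobeniusTrace 5 = 0 →
      (∀ m : ℕ, V.HasSurjectiveModNGaloisRep (5 ^ m : ℕ)) →
      (∃ (W : WeierstrassCurve ℚ) (_ : W.IsElliptic) (_ : W.IsGloballyMinimal) (C : VariableChange ℚ),
        C • W.quadraticTwist ((-1) ^ (5 / 2) * 5) = V ∧ Addv W 5 ∧ SubGss W 5 ∧
          FWNonsplitRam W 5 ∧ Kato2004.ImageContainsSL2 W 5) →
      QuadraticBranchPlusLowerInclusionAt V 5 :=
  fun V _ _ _ hgood hap hs hL => hfw V 5 le_rfl hgood hap hs hL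

/-- **The BC5 rung from the two shapes** (`stub_plusLower_five_rung_of_fwLocus` ∘
`stub_plusLower_fwLocus_of_shapes`): granted the Fouquet–Wan claim-shape and the bridge, the `p = 5`
rows of the sub-locus have (E⁺). CONDITIONAL; closes nothing.
[cite: FouquetWan2021, Thm. 5.1 (claim; hypothesis only)] -/
theorem stub_plusLower_five_rung_of_shapes
    (hFW : FouquetWanClaimShape KMC) (hB : QuadraticBranchKatoBridge KMC) :
    ∀ (V : WeierstrassCurve ℚ) [V.IsElliptic] [V.IsGloballyMinimal] [Fact (5 : ℕ).Prime],
      V.HasGoodReductionAtPrime 5 → V.frobeniusTrace 5 = 0 →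
      (∀ m : ℕ, V.HasSurjectiveModNGaloisRep (5 ^ m : ℕ)) →
      (∃ (W : WeierstrassCurve ℚ) (_ : W.IsElliptic) (_ : W.IsGloballyMinimal) (C : VariableChange ℚ),
        C • W.quadraticTwist ((-1) ^ (5 / 2) * 5) = V ∧ Addv W 5 ∧ SubGss W 5 ∧
          FWNonsplitRam W 5 ∧ Kato2004.ImageContainsSL2 W 5) →
      QuadraticBranchPlusLowerInclusionAt V 5 :=
  stub_plusLower_five_rung_of_fwLocus (stub_plusLower_fwLocus_of_shapes hFW hB)

/-! ## §2 The locus composition in the tree -/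

/-- **The skeleton's composition `PlusLowerInclusionSurjBranch_of` in the tree**: the sub-locus stub
`Sig.stub_plusLower_fwLocus` and the off-locus stub `Sig.stub_plusLower_offLocus` (both VERBATIM,
displayed as hypotheses) give the crux `PlusLowerInclusionSurjBranch` BY NAME (`by_cases` on the
locus). CONDITIONAL on both stubs; closes nothing. [folklore] -/
theorem plusLowerInclusionSurjBranch_of_fwLocus_of_offLocus
    (hfw : ∀ (V : WeierstrassCurve ℚ) [V.IsElliptic] [V.IsGloballyMinimal] (p : ℕ) [Fact p.Prime],
      5 ≤ p → V.HasGoodReductionAtPrime p → V.frobeniusTrace p = 0 →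
      (∀ m : ℕ, V.HasSurjectiveModNGaloisRep (p ^ m : ℕ)) →
      (∃ (W : WeierstrassCurve ℚ) (_ : W.IsElliptic) (_ : W.IsGloballyMinimal) (C : VariableChange ℚ),
        C • W.quadraticTwist ((-1) ^ (p / 2) * p) = V ∧ Addv W p ∧ SubGss W p ∧
          FWNonsplitRam W p ∧ Kato2004.ImageContainsSL2 W p) →
      QuadraticBranchPlusLowerInclusionAt V p)
    (hoff : ∀ (V : WeierstrassCurve ℚ) [V.IsElliptic] [V.IsGloballyMinimal] (p : ℕ) [Fact p.Prime],
      5 ≤ p → V.HasGoodReductionAtPrime p → V.frobeniusTrace p = 0 →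
      (∀ m : ℕ, V.HasSurjectiveModNGaloisRep (p ^ m : ℕ)) →
      ¬ (∃ (W : WeierstrassCurve ℚ) (_ : W.IsElliptic) (_ : W.IsGloballyMinimal) (C : VariableChange ℚ),
        C • W.quadraticTwist ((-1) ^ (p / 2) * p) = V ∧ Addv W p ∧ SubGss W p ∧
          FWNonsplitRam W p ∧ Kato2004.ImageContainsSL2 W p) →
      QuadraticBranchPlusLowerInclusionAt V p) :
    PlusLowerInclusionSurjBranch := by
  intro V _ _ p _ h5 hg ha hs
  by_cases hL : ∃ (W : WeierstrassCurve ℚ) (_ : W.IsElliptic) (_ : W.IsGloballyMinimal)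
      (C : VariableChange ℚ), C • W.quadraticTwist ((-1) ^ (p / 2) * p) = V ∧ Addv W p ∧ SubGss W p ∧
        FWNonsplitRam W p ∧ Kato2004.ImageContainsSL2 W p
  · exact hfw V p h5 hg ha hs hL
  · exact hoff V p h5 hg ha hs hL

/-- **The crux BY NAME from the two shapes and the off-locus stub ALONE.** Granted
`FouquetWanClaimShape KMC` (unrefereed claim, hypothesis only) and `QuadraticBranchKatoBridge KMC`
(hypothesis only), item 19242 `PlusLowerInclusionSurjBranch` follows from `Sig.stub_plusLower_offLocus`
(VERBATIM, displayed): modulo the claim and the bridge the crux IS its off-locus stub — the Eisenstein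
inclusion for the additive twist on the tower-onto twists with NO Gss2 partner carrying a ramified
non-split Steinberg prime and `SL₂`-image, where nothing is in print. CONDITIONAL; closes nothing.
[cite: FouquetWan2021, Thm. 5.1 and Thm. 1.7 (claim; hypothesis only)]
[cite: Kato2004Asterisque, Conj. 12.10 (p. 224)] -/
theorem plusLowerInclusionSurjBranch_of_shapes_of_offLocus
    (hFW : FouquetWanClaimShape KMC) (hB : QuadraticBranchKatoBridge KMC)
    (hoff : ∀ (V : WeierstrassCurve ℚ) [V.IsElliptic] [V.IsGloballyMinimal] (p : ℕ) [Fact p.Prime],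
      5 ≤ p → V.HasGoodReductionAtPrime p → V.frobeniusTrace p = 0 →
      (∀ m : ℕ, V.HasSurjectiveModNGaloisRep (p ^ m : ℕ)) →
      ¬ (∃ (W : WeierstrassCurve ℚ) (_ : W.IsElliptic) (_ : W.IsGloballyMinimal) (C : VariableChange ℚ),
        C • W.quadraticTwist ((-1) ^ (p / 2) * p) = V ∧ Addv W p ∧ SubGss W p ∧
          FWNonsplitRam W p ∧ Kato2004.ImageContainsSL2 W p) →
      QuadraticBranchPlusLowerInclusionAt V p) :
    PlusLowerInclusionSurjBranch :=
  plusLowerInclusionSurjBranch_of_fwLocus_of_offLocus (stub_plusLower_fwLocus_of_shapes hFW hB) hoff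

/-! ## §3 The tower hypothesis of the crux is the mod-`p` hypothesis (`p ≥ 5`, Serre) -/

/-- **At `p ≥ 5`, "`ρ_{V,p^m}` onto for every `m`" ⟺ "`ρ̄_{V,p}` onto"** (Serre, Abelian ℓ-adic
representations, IV-23 Lemma 3: a closed subgroup of `GL₂(ℤ_p)`, `p ≥ 5`, surjecting onto
`GL₂(𝔽_p)` is everything; tree theorem `serre_hasSurjectiveModNGaloisRep_pow_holds`).
[cite: SerreAbelianLadic1968, Ch. IV §3.4 Lemma 3 (IV-23)] -/
theorem hasSurjectiveModNGaloisRep_pow_iff (V : WeierstrassCurve ℚ) [V.IsElliptic] (p : ℕ)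
    [Fact p.Prime] (hp5 : 5 ≤ p) :
    (∀ m : ℕ, V.HasSurjectiveModNGaloisRep (p ^ m : ℕ)) ↔ V.HasSurjectiveModNGaloisRep p := by
  refine ⟨fun h => ?_, fun h => serre_hasSurjectiveModNGaloisRep_pow_holds V p hp5 h⟩
  simpa using h 1

/-- **The crux `PlusLowerInclusionSurjBranch` read with the mod-`p` condition**: at `p ≥ 5` the item
is equivalent to «for every good `a_p = 0` twist `V` with `ρ̄_{V,p}` ONTO, (E⁺) holds» — the form the
census decides per pair (surjectivity mod `p`), by Serre's lemma (`hasSurjectiveModNGaloisRep_pow_iff`).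
Bookkeeping; asserts nothing about (E⁺). [cite: SerreAbelianLadic1968, Ch. IV §3.4 Lemma 3 (IV-23)] -/
theorem plusLowerInclusionSurjBranch_iff_modP :
    PlusLowerInclusionSurjBranch ↔
      ∀ (V : WeierstrassCurve ℚ) [V.IsElliptic] [V.IsGloballyMinimal] (p : ℕ) [Fact p.Prime],
        5 ≤ p → V.HasGoodReductionAtPrime p → V.frobeniusTrace p = 0 →
        V.HasSurjectiveModNGaloisRep p → QuadraticBranchPlusLowerInclusionAt V p := by
  refine ⟨fun h V _ _ p _ h5 hg ha hs => h V p h5 hg ha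
      ((hasSurjectiveModNGaloisRep_pow_iff V p h5).2 hs),
    fun h V _ _ p _ h5 hg ha hs => h V p h5 hg ha ((hasSurjectiveModNGaloisRep_pow_iff V p h5).1 hs)⟩

/-- **Dually, the declared residual `PlusMainConjectureNonsurjBranch` (item 19243) read with the
mod-`p` condition**: at `p ≥ 5` it is equivalent to «(C1_η) on the good `a_p = 0` twists `V` with
`ρ̄_{V,p}` NOT onto» (the CM twists and the non-CM twists with image in a Cartan normaliser or
exceptional). Bookkeeping; asserts nothing about (C1_η).
[cite: SerreAbelianLadic1968, Ch. IV §3.4 Lemma 3 (IV-23)] -/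
theorem plusMainConjectureNonsurjBranch_iff_modP :
    PlusMainConjectureNonsurjBranch ↔
      ∀ (V : WeierstrassCurve ℚ) [V.IsElliptic] [V.IsGloballyMinimal] (p : ℕ) [Fact p.Prime],
        5 ≤ p → V.HasGoodReductionAtPrime p → V.frobeniusTrace p = 0 →
        ¬ V.HasSurjectiveModNGaloisRep p → QuadraticBranchPlusMainConjectureAt V p := by
  refine ⟨fun h V _ _ p _ h5 hg ha hs => h V p h5 hg ha
      (fun hs' => hs ((hasSurjectiveModNGaloisRep_pow_iff V p h5).1 hs')),
    fun h V _ _ p _ h5 hg ha hs => h V p h5 hg ha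
      (fun hs' => hs ((hasSurjectiveModNGaloisRep_pow_iff V p h5).2 hs'))⟩

end Summit.BirchSwinnertonDyer.BirchSwinnertonDyer.Theorems

end
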